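import Literature.AlgebraicGeometry.Crystalline.DeRhamComplexHodgeSheaves
import Literature.AlgebraicGeometry.Motives.HodgeSheavesProofs
import Literature.AlgebraicGeometry.Modules.IsoOfSectionsOnBasis
import Literature.Algebra.Homology.StupidFiltrationDegeneration
import HarnessLib

/-!
# `Ωᵃ_{X/k} = 0` for `a > d` on a `k`-scheme smooth of relative dimension `d`, and the trivial
# range of Hodge–de Rham degeneration

Let `X → Spec k` be smooth of relative dimension `d` (Mathlib's `SmoothOfRelativeDimension d`; `k` any
commutative ring). Then the Hodge sheaves `Ωᵃ_{X/k} = ⋀ᵃ Ω¹_{X/k}` (`Motives.hodgeSheaf X a`) VANISH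
for `a > d`, because `Ω¹_{X/k}` is locally free of rank `d` (R. Hartshorne, *Algebraic Geometry*
(1977), II Thm. 8.15 / III Prop. 10.4; The Stacks project, Tag 02G1) and `⋀ᵃ` of a free module of
rank `d` is free on the `a`-element subsets of a `d`-element set (loc. cit. II Ex. 5.16(a)), of
which there are none. Everything is proved, from the tree's discharged local-freeness results
(`Motives/HodgeSheavesProofs`: `exists_basis_sections_cotangentSheaf_of_isStandardSmoothOfRelativeDimension`,
`nonempty_basis_sections_hodgeSheaf`) and sheaf locality on a basis
(`Modules/IsoOfSectionsOnBasis.eq_zero_of_map_eq_zero_on_basis`); no named facts.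

* `exists_basis_sections_cotangentSheaf_le`, `isBasis_setOf_basis_sections_cotangentSheaf` — the
  affine opens `V` with `Γ(V, Ω¹)` free of rank `d` form a basis of the topology;
* `hodgeSheaf_sections_eq_zero_of_lt`, **`isZero_hodgeSheaf_of_lt`**, `isZero_toSheaf_hodgeSheaf_of_lt`,
  `subsingleton_hodgeCohomology_of_lt_degree` — `Γ(U, Ωᵃ) = 0`, `Ωᵃ = 0` (as `𝒪_X`-module and as
  abelian sheaf) and `Hᵇ(X, Ωᵃ) = 0` for `a > d`;
* **`isZero_algebraicDeRhamComplex_X_of_lt`**, `isZero_algebraicDeRhamComplex_extend_X_of_lt`,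
  `isStrictlyLE_algebraicDeRhamComplex_extend` — the terms of the algebraic de Rham complex
  `Ω•_{X/k}` (`Crystalline/DeRhamComplexSheaf.algebraicDeRhamComplex`, through
  `Crystalline/DeRhamComplexHodgeSheaves.algebraicDeRhamComplexXIso : (Ω•)ᵃ ≅ (Ωᵃ)^{ab}`) vanish above
  degree `d`; its `ℤ`-extension is strictly concentrated in degrees `[0, d]`;
* **`stupidFiltration_delta_eq_zero_of_lt`** (and the primed spelling on
  `shortExact_stupidFiltration`) — for `n₀ + 1 = n₁ > d` the connecting homomorphisms
  `δ : HyperExt A (σ≤n₀ Ω•) k₀ → HyperExt A (Ωⁿ¹[-n₁]) k₁` of the stupid (Hodge) filtration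
  (`Algebra/Homology/StupidFiltration.stupidFiltrationShortComplex`) are ZERO for every abelian sheaf
  `A` (for `A = ℤ`: on hypercohomology). This is the trivial range `n₁ > d` of the degeneration
  statement `Crystalline.HodgeDeRhamDegeneratesModTorsion` (`Crystalline/HodgeDeRhamDegeneration`,
  Deligne 1968 Thm. 5.5 (ii)), which it settles outright (checked against that statement's exact
  binder shape); the content of that named fact lies in the columns `1 ≤ n₁ ≤ d` and is NOT touched
  here.

References: R. Hartshorne, *Algebraic Geometry*, GTM 52 (1977), II Ex. 5.16(a), II Thm. 8.15,
III.7 p. 225; The Stacks project, Tags 02G1, 01CG, 0FKL. [folklore]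
-/

noncomputable section

open CategoryTheory Limits Opposite TopologicalSpace
open _root_.AlgebraicGeometry
open Literature.AlgebraicGeometry.Motives Literature.AlgebraicGeometry.Modules

universe u

namespace Literature.AlgebraicGeometry.Crystalline

section HodgeSheaf

-- `TopCat.Presheaf`/`TopCat.Sheaf` are not reducible: as in Mathlib's `AlgebraicGeometry.Modules`.
set_option backward.isDefEq.respectTransparency false

variable {k : Type u} [CommRing k] (X : Over (Spec (CommRingCat.of k))) (d : ℕ)
  [SmoothOfRelativeDimension d X.hom]

/-- Inside every open neighbourhood of a point of a `k`-scheme smooth of relative dimension `d`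
there is an affine open `V` with `Γ(V, Ω¹_{X/k})` free of rank `d` over `Γ(X, V)` (the tree's
`Motives.exists_basis_sections_cotangentSheaf`, run inside a given open `U`). [folklore] -/
theorem exists_basis_sections_cotangentSheaf_le {U : X.left.Opens} {x : X.left} (hx : x ∈ U) :
    ∃ V : X.left.Opens, IsAffineOpen V ∧ x ∈ V ∧ V ≤ U ∧ ∃ ι : Type u, Finite ι ∧ Nat.card ι = d ∧
      Nonempty (Module.Basis ι Γ(X.left, V) Γ(cotangentSheaf X, V)) := by
  obtain ⟨W, hW, hxW, hWU⟩ := exists_isAffineOpen_mem_and_subset (U := U) hx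
  have hloc := HasRingHomProperty.appLE (@SmoothOfRelativeDimension d) X.hom ‹_›
    ⟨⊤, isAffineOpen_top _⟩ ⟨W, hW⟩ le_top
  obtain ⟨s, hs, hst⟩ := (RingHom.locally_iff_isLocalization
    RingHom.isStandardSmoothOfRelativeDimension_respectsIso _).mp hloc
  obtain ⟨⟨t, ht⟩, hxt⟩ := Opens.mem_iSup.mp
    (hW.self_le_iSup_basicOpen_iff.mpr (by exact_mod_cast hs) hxW)
  refine ⟨X.left.basicOpen t, hW.basicOpen t, hxt, (X.left.basicOpen_le t).trans hWU, ?_⟩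
  haveI : Nonempty (X.left.basicOpen t) := ⟨⟨x, hxt⟩⟩
  apply exists_basis_sections_cotangentSheaf_of_isStandardSmoothOfRelativeDimension X d
    (hW.basicOpen t)
  haveI := hW.isLocalization_basicOpen t
  have hfg : ((constToPresheaf X).app (op (X.left.basicOpen t))).hom =
      (algebraMap Γ(X.left, W) Γ(X.left, X.left.basicOpen t)).comp
        ((constToPresheaf X).app (op W)).hom := by
    ext r
    have h := CategoryTheory.congr_fun
      ((constToPresheaf X).naturality (homOfLE (X.left.basicOpen_le t)).op) r
    simp only [Functor.const_obj_map, CommRingCat.comp_apply] at h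
    exact h
  have h1 : ((constToPresheaf X).app (op W)).hom = (X.hom.appLE ⊤ W le_top).hom.comp
      (Scheme.ΓSpecIso (CommRingCat.of k)).commRingCatIsoToRingEquiv.symm.toRingHom :=
    RingHom.ext fun r => rfl
  rw [hfg, h1, ← RingHom.comp_assoc]
  exact RingHom.isStandardSmoothOfRelativeDimension_respectsIso.2 _ _
    (hst t ht Γ(X.left, X.left.basicOpen t))

/-- The affine opens `V` with `Γ(V, Ω¹_{X/k})` free of rank `d` form a basis of the topology of a
`k`-scheme smooth of relative dimension `d`. [folklore] -/
theorem isBasis_setOf_basis_sections_cotangentSheaf :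
    Opens.IsBasis {V : X.left.Opens | IsAffineOpen V ∧ ∃ ι : Type u, Finite ι ∧ Nat.card ι = d ∧
      Nonempty (Module.Basis ι Γ(X.left, V) Γ(cotangentSheaf X, V))} := by
  refine Opens.isBasis_iff_nbhd.mpr fun {U x} hx => ?_
  obtain ⟨V, hV, hxV, hVU, hb⟩ := exists_basis_sections_cotangentSheaf_le X d hx
  exact ⟨V, ⟨hV, hb⟩, hxV, hVU⟩

/-- **`Ωᵃ_{X/k}` has no non-zero sections for `a > d`** on a `k`-scheme smooth of relative
dimension `d`: over the affine opens `V` where `Ω¹` is free of rank `d`, `Γ(V, Ωᵃ) ≅ ⋀ᵃ Γ(V, Ω¹)` is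
free on the `a`-element subsets of a `d`-element set, of which there are none; these opens form a
basis, so every section vanishes by sheaf locality. [folklore] -/
theorem hodgeSheaf_sections_eq_zero_of_lt {a : ℕ} (ha : d < a) (U : X.left.Opens)
    (s : Γ(hodgeSheaf X a, U)) : s = 0 := by
  refine eq_zero_of_map_eq_zero_on_basis (isBasis_setOf_basis_sections_cotangentSheaf X d) s ?_
  rintro V ⟨hV, ι, hfin, hcard, ⟨b⟩⟩ hVU
  obtain ⟨bV⟩ := nonempty_basis_sections_hodgeSheaf X a hV b
  haveI : IsEmpty (Set.powersetCard ι a) := by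
    haveI := hfin
    exact Set.isEmpty_coe_sort.mpr (Set.powersetCard.eq_empty_iff.mpr (hcard ▸ ha))
  exact bV.repr.injective (Subsingleton.elim _ _)

/-- **`Ωᵃ_{X/k} = 0` for `a > d`** on a `k`-scheme smooth of relative dimension `d` (as an
`𝒪_X`-module). [folklore] -/
theorem isZero_hodgeSheaf_of_lt {a : ℕ} (ha : d < a) : IsZero (hodgeSheaf X a) := by
  rw [IsZero.iff_id_eq_zero]
  refine Scheme.Modules.hom_ext _ _ fun W => ?_
  ext y
  rw [hodgeSheaf_sections_eq_zero_of_lt X d ha W y, map_zero, map_zero]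

/-- `Ωᵃ_{X/k} = 0` for `a > d`, for the underlying abelian sheaf (the sheaf whose `Sheaf.H` is
`Motives.hodgeCohomology X a b`). [folklore] -/
theorem isZero_toSheaf_hodgeSheaf_of_lt {a : ℕ} (ha : d < a) :
    IsZero ((SheafOfModules.toSheaf X.left.ringCatSheaf).obj (hodgeSheaf X a)) :=
  Functor.map_isZero _ (isZero_hodgeSheaf_of_lt X d ha)

/-- The Hodge cohomology groups `Hᵇ(X, Ωᵃ_{X/k})` vanish for `a > d`. [folklore] -/
theorem subsingleton_hodgeCohomology_of_lt_degree {a : ℕ} (ha : d < a) (b : ℕ) :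
    Subsingleton (hodgeCohomology X a b) :=
  Sheaf.subsingleton_H_of_isZero (isZero_toSheaf_hodgeSheaf_of_lt X d ha) b

end HodgeSheaf

/-! ### The terms of the algebraic de Rham complex above the relative dimension -/

section DeRham

variable {k : Type u} [CommRing k] (X : Over (Spec (CommRingCat.of k))) (d : ℕ)
  [SmoothOfRelativeDimension d X.hom]

/-- **`(Ω•_{X/k})ᵃ = 0` for `a > d`**: the terms of the algebraic de Rham complex
(`Crystalline.algebraicDeRhamComplex X`) of a `k`-scheme smooth of relative dimension `d` vanish
above degree `d` (through `algebraicDeRhamComplexXIso : (Ω•)ᵃ ≅ (Ωᵃ)^{ab}`). [folklore] -/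
theorem isZero_algebraicDeRhamComplex_X_of_lt {a : ℕ} (ha : d < a) :
    IsZero ((algebraicDeRhamComplex X).X a) :=
  (isZero_toSheaf_hodgeSheaf_of_lt X d ha).of_iso (algebraicDeRhamComplexXIso X a)

/-- The same for the `ℤ`-indexed extension `(Ω•).extend embeddingUpNat` (zero in negative degrees):
its degree-`n` term vanishes for every integer `n > d`. [folklore] -/
theorem isZero_algebraicDeRhamComplex_extend_X_of_lt {n : ℤ} (hn : (d : ℤ) < n) :
    IsZero (((algebraicDeRhamComplex X).extend ComplexShape.embeddingUpNat).X n) := by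
  have hn' : ((n.toNat : ℕ) : ℤ) = n := Int.toNat_of_nonneg (by omega)
  exact (isZero_algebraicDeRhamComplex_X_of_lt X d (a := n.toNat) (by omega)).of_iso
    ((algebraicDeRhamComplex X).extendXIso ComplexShape.embeddingUpNat hn')

/-- The algebraic de Rham complex of a `k`-scheme smooth of relative dimension `d`, as a `ℤ`-indexed
complex, is strictly concentrated in degrees `≤ d`. [folklore] -/
theorem isStrictlyLE_algebraicDeRhamComplex_extend :
    CochainComplex.IsStrictlyLE
      ((algebraicDeRhamComplex X).extend ComplexShape.embeddingUpNat) (d : ℤ) := by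
  rw [CochainComplex.isStrictlyLE_iff]
  intro n hn
  exact isZero_algebraicDeRhamComplex_extend_X_of_lt X d hn

end DeRham

/-! ### Consequence for the stupid (Hodge) filtration: the connecting maps vanish above `d` -/

section StupidFiltration

open Literature.Algebra.Homology

universe w

variable {k : Type u} [CommRing k] (X : Over (Spec (CommRingCat.of k))) (d : ℕ)
  [SmoothOfRelativeDimension d X.hom]

/-- **The connecting maps of the Hodge filtration vanish above the relative dimension.** For a
`k`-scheme `X` smooth of relative dimension `d`, `Ω• = (algebraicDeRhamComplex X).extend embeddingUpNat`
and `n₀ + 1 = n₁` with `d < n₁`, the connecting homomorphism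
`δ : HyperExt A (σ≤n₀ Ω•) k₀ → HyperExt A (Ωⁿ¹[-n₁]) k₁` of the short exact sequence
`0 → Ωⁿ¹[-n₁] → σ≤n₁ Ω• → σ≤n₀ Ω• → 0` (`Algebra/Homology/StupidFiltration`) is zero, for every
object `A` of abelian sheaves (e.g. the constant sheaf `ℤ`: hypercohomology), simply because
`Ωⁿ¹ = 0`. This is the trivial range of the `E₁`-degeneration statement
`Crystalline.HodgeDeRhamDegeneratesModTorsion` (`Crystalline/HodgeDeRhamDegeneration`), whose content
lies in the columns `n₁ ≤ d`. The two `HasHyperExt` hypotheses (those of `HyperExt.delta`) are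
implicit rather than instance arguments so that the lemma rewrites a goal `δ x = 0` whatever
instance terms it carries (e.g. the `haveI`-provided ones of that named fact's statement).
[folklore] -/
theorem stupidFiltration_delta_eq_zero_of_lt
    (A : Sheaf (Opens.grothendieckTopology X.left) AddCommGrpCat.{u})
    (n₀ n₁ : ℤ) (h : n₀ + 1 = n₁) (hn : (d : ℤ) < n₁) (k₀ k₁ : ℤ) (hk : k₀ + 1 = k₁)
    {_ : HasHyperExt.{w} A (stupidFiltrationShortComplex
        ((algebraicDeRhamComplex X).extend ComplexShape.embeddingUpNat) n₀ n₁ h).X₁}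
    {_ : HasHyperExt.{w} A (stupidFiltrationShortComplex
        ((algebraicDeRhamComplex X).extend ComplexShape.embeddingUpNat) n₀ n₁ h).X₃}
    (x : HyperExt.{w} A (stupidFiltrationShortComplex
        ((algebraicDeRhamComplex X).extend ComplexShape.embeddingUpNat) n₀ n₁ h).X₃ k₀) :
    HyperExt.delta (shortExact_stupidFiltrationShortComplex
      ((algebraicDeRhamComplex X).extend ComplexShape.embeddingUpNat) n₀ n₁ h) k₀ k₁ hk x = 0 := by
  have h₁ : IsZero (stupidFiltrationShortComplex
      ((algebraicDeRhamComplex X).extend ComplexShape.embeddingUpNat) n₀ n₁ h).X₁ := by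
    change IsZero ((CochainComplex.singleFunctor _ n₁).obj
      (((algebraicDeRhamComplex X).extend ComplexShape.embeddingUpNat).X n₁))
    exact Functor.map_isZero _ (isZero_algebraicDeRhamComplex_extend_X_of_lt X d hn)
  exact HyperExt.eq_zero_of_isZero h₁ _

/-- The same vanishing, with the short exact sequence in the spelling
`shortExact_stupidFiltration` of `Algebra/Homology/StupidFiltrationDegeneration` (objects
syntactically `Ωⁿ¹[-n₁]`, `σ≤n₁ Ω•`, `σ≤n₀ Ω•`), the form used by the consumers of the degeneration
statement (`Crystalline/StaircaseIntegralDegeneration`). [folklore] -/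
theorem stupidFiltration_delta_eq_zero_of_lt'
    (A : Sheaf (Opens.grothendieckTopology X.left) AddCommGrpCat.{u})
    (n₀ n₁ : ℤ) (h : n₀ + 1 = n₁) (hn : (d : ℤ) < n₁) (k₀ k₁ : ℤ) (hk : k₀ + 1 = k₁)
    {_ : HasHyperExt.{w} A ((CochainComplex.singleFunctor _ n₁).obj
        (((algebraicDeRhamComplex X).extend ComplexShape.embeddingUpNat).X n₁))}
    {_ : HasHyperExt.{w} A
        (stupidTruncLE ((algebraicDeRhamComplex X).extend ComplexShape.embeddingUpNat) n₀)}
    (x : HyperExt.{w} A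
        (stupidTruncLE ((algebraicDeRhamComplex X).extend ComplexShape.embeddingUpNat) n₀) k₀) :
    HyperExt.delta (shortExact_stupidFiltration
      ((algebraicDeRhamComplex X).extend ComplexShape.embeddingUpNat) n₀ n₁ h) k₀ k₁ hk x = 0 :=
  stupidFiltration_delta_eq_zero_of_lt X d A n₀ n₁ h hn k₀ k₁ hk x

end StupidFiltration


end Literature.AlgebraicGeometry.Crystalline

end
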